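import Summits.QuantumFields.BalabanUV.Beta.MultiscaleParametrixWRS
import Summits.QuantumFields.BalabanUV.Beta.MultiscaleRemainderWRS
import Summits.QuantumFields.BalabanUV.Beta.MultiscaleSupRowSumsDirichlet
import Summits.QuantumFields.BalabanUV.Beta.MultiscaleGradRowSumsDirichlet
import Summits.QuantumFields.BalabanUV.Beta.MultiscaleParametrixCubesKSites
import Summits.QuantumFields.BalabanUV.Beta.MultiscaleParametrixTorus

/-!
# Beta / MultiscaleParametrixCubesWRS — THE END OF THE (w4-d)-FLAT PROGRAMME AT MODEL LEVEL: THE SCALE-ADAPTED PARAMETRIX OF THE MULTI-REGION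
# MODEL OPERATOR IN THE (2.16)∕WRS CURRENCY FOR THE CUBE FAMILY `cubeFam` AND ANY HULL FAMILY WITH A MARGIN — `wrs_{κ′,d_n}(cmat (levelOp)⁻¹)(p)
# ≤ ν·𝔅_W·n(p₁)²∕(1 − ν·C_K)`, `(levelOp)⁻¹ = G′₀(1 − R′)⁻¹`, `WRS(cmat R′) ≤ νC_K`, `WRS(cmat (1 − R′)⁻¹) ≤ (1 − νC_K)⁻¹`, `C_K = C_K⁰∕M` LEVEL-FREE
# (flat transport, constant bond weight; d = 4 hypothesis-free via `FlatGradientBinderD4`, general `d` modulo (FG); claim «WRS-PARAMETRIX-FLAT»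
# journal l.25540; unit `b2b-balaban-beta-d4-p2`, GEN 12, MODEL crew)

ASSEMBLY BY NAME (kernel, 0 sorry, no definition): brick (d) `MultiscaleParametrixWRS.parametrix_levelOp_wrs` with, per box `□ = (j,z)`:
the remainder rows by brick (c) `MultiscaleRemainderWRS.row_remK_mul_le` for `P = G′_□·M_{h_□}` — bump data `θ₁ = |c₀|K₁∕(MS_j)`
(`cubeFam_cdh_le`), `θ₂ = c₀²dK₂∕(MS_j)²` (`cubeFam_lap_le`), `m = dLK₁∕M` (`cubeFam_cell_osc_le`), `Λ = L·S_j`; K-margin `Kint_□(x) :≡ □ active ∧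
dist(x, corner) ≤ r₀ = (d+2)MS_j + 2dLS_j + 1` (`MultiscaleParametrixCubesKSites`); members (W1) `wrs_dirInv_le_of_grading`, (W2)
`wrs_grad_dirInv_le_of_grading` through `row_mul_mulOp_le`, their interiority from the HULL-MARGIN clause `hχball` («the hull of an active
box contains the torus ball of radius `r₀ + (8d+3)·L^A e^{(log L∕R)(8d+3)}·LS_j` about its corner» — discharged for `cubeHullR` by
`MultiscaleParametrixCubesMargin.hullR_eq_one_of_sdist_le`) via `eq_one_of_sdist_le_of_ball`; row support by `remK_mul_apply_eq_zero`; the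
local part by `row_mulOp_mul_eq` + (W1); counts `ν_K, ν ≤ Σ_□ χ_□ ≤ ν` by `card_Kset_le`.  RESULT **`parametrix_cubes_wrs`**.

HONEST FRAMING: discharging `BetaPertH` makes Bałaban's UV stability UNCONDITIONAL — NOT the continuum limit, NOT the
Clay problem.  HONEST DEPENDENCY (verbatim): «continuum YM on T⁴ ⇐ BetaPertH ∧ nine spine estimates (0/9 proved);
BetaPertH ⇐ (D1) ∧ (D4) ∧ CAP+tail; G-an2-4 gates asym, D1 and NE2/3/4.»  THIS MODULE DISCHARGES NOTHING of `BetaPertH`,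
asserts NOTHING printed and cites nothing as a fact (ABSOLUTE RULE): [folklore] assembly of this lineage's MODEL theorems BY NAME about pv21's
component MODEL with FLAT transport and a CONSTANT bond weight; the layer predicate, (C0)–(C2), (G1), the hull clauses and the counts are
DATA; (FG) is a HYPOTHESIS for general `d` (discharged in d = 4 by `FlatGradientBinderD4.flatGradient_binder_d4`).  Nothing of Bałaban's
G′(U)∕random-walk expansion is asserted: (3.87)–(3.91) pp. 408–409 + Thm 3.7 of [Balaban1985BackgroundPropagators], (2.36)–(2.40) pp. 229–230 of
[Balaban1984PropagatorsII], (2.16) p. 15 of [Balaban1988RG2Cluster] are LOCI.  No class change on row D4 (critical-path width 0; D4 DISCHARGE NO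
DATE); NOT BetaPertH, NOT continuum, NOT Clay, NOT summit progress.
-/

open scoped BigOperators
open Finset

namespace Summit.QuantumFields.BalabanUV.Beta.MultiscaleParametrixCubesWRS

open Summit.QuantumFields.BalabanUV.Beta.BoxPoincare (Box)
open Summit.QuantumFields.BalabanUV.Beta.MultiscaleCoerciveTorus
open Summit.QuantumFields.BalabanUV.Beta.MultiscaleDistance
open Summit.QuantumFields.BalabanUV.Beta.MultiscaleDistanceMetric (weightHyp_sdist_torus)
open Summit.QuantumFields.BalabanUV.Beta.MultiscaleDecayBudget
open Summit.QuantumFields.BalabanUV.Beta.SubsolutionMeanValueBox (Cmv)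
open Summit.QuantumFields.BalabanUV.Beta.MultiscaleParametrixWRS (parametrix_levelOp_wrs)
open Summit.QuantumFields.BalabanUV.Beta.MultiscaleRemainderWRS
open Summit.QuantumFields.BalabanUV.Beta.MultiscaleSupRowSumsDirichlet (wrs_dirInv_le_of_grading)
open Summit.QuantumFields.BalabanUV.Beta.MultiscaleGradRowSumsDirichlet (wrs_grad_dirInv_le_of_grading)
open Summit.QuantumFields.BalabanUV.Beta.MultiscaleParametrixCubesKSites
open Summit.QuantumFields.BalabanUV.Beta.MultiscaleAveragingKernel (tblk_eq_zc)
open Summit.QuantumFields.BalabanUV.Beta.MultiscaleParametrixTorus (posDef_of_coercive blockConst_of_cellConst)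
open Summit.QuantumFields.BalabanUV.Beta.MultiscaleParametrixHull (CellMeets)
open Summit.QuantumFields.BalabanUV.Beta.MultiscaleCubesFamily
open Summit.QuantumFields.BalabanUV.Beta.MultiscaleParametrixCubes
open Summit.QuantumFields.BalabanUV.Beta.MultiscaleParametrixBoxes (one_le_MS)
open Summit.QuantumFields.BalabanUV.Beta.CovariantTowerMatrix (cmat wrs_cmat_eq)
open Literature.MathematicalPhysics.QuantumFieldTheory.Balaban1983to89
open Literature.MathematicalPhysics.QuantumFieldTheory.Balaban1983to89.B9Thm37Sum (mulOp mulOp_apply)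
open Literature.MathematicalPhysics.QuantumFieldTheory.Balaban1983to89.B9Thm37Glue (covD)
open Literature.MathematicalPhysics.QuantumFieldTheory.Balaban1983to89.B9Thm37GluePU (bsrc btgt bsrc_apply btgt_apply)
open Literature.MathematicalPhysics.QuantumFieldTheory.Balaban1983to89.B9Thm37GlueTorusInv (dirInv)
open Literature.MathematicalPhysics.QuantumFieldTheory.Balaban1983to89.B9Thm37GlueTorusCov (tblk)
open Literature.MathematicalPhysics.QuantumFieldTheory.Balaban1983to89.B9Thm37GlueTorusCovLevels (levelOp levelSum)
open Literature.MathematicalPhysics.QuantumFieldTheory.Balaban1983to89.B13PerturbativeStep (WRS wrs)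
open Summit.QuantumFields.BalabanUV.Beta.MultiscaleRemainderLeibniz (lapH remK)
open Summit.QuantumFields.BalabanUV.Beta.MultiscaleParametrix (G0sum Rsum)
open B5TorusCover (UT Ctr ctrU)
open B5Leibniz121 (up)

noncomputable section

variable {d : ℕ} {N : Fin d → ℕ} [∀ i, NeZero (N i)] [NeZero d] {Cp J K : Type} [Fintype Cp] [DecidableEq Cp] [Nonempty Cp]
  [Fintype J] [DecidableEq J] [Fintype K] [DecidableEq K] (S : J → ℕ) (hS : ∀ l, 1 ≤ S l) (hdivS : ∀ l i, S l ∣ N i) (lvl : K → J)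
  (zc : (k : K) → Ctr N (S (lvl k)))
  (hdisj : ∀ k k' v v', cellPt S hS hdivS lvl zc k v = cellPt S hS hdivS lvl zc k' v' → k = k')
  (hcover : ∀ x : UT N, ∃ k, ∃ v : Box d (S (lvl k)), cellPt S hS hdivS lvl zc k v = x)
  (Rm : UT N × Fin d → Cp → Cp → ℝ) (hRm : ∀ b i j, ∑ k, Rm b k i * Rm b k j = if i = j then (1 : ℝ) else 0)
  (hflat : ∀ b k i, Rm b k i = if k = i then 1 else 0)
  (T : J → UT N → Cp → Cp → ℝ) (hT : ∀ l x i i', ∑ k, T l x k i * T l x k i' = if i = i' then (1 : ℝ) else 0)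
  (a : J → ℝ) (ha : ∀ j, 0 ≤ a j) (ω : J → UT N → ℝ)
  (hsupp : ∀ l x, ω l (ctrU N (S l) (tblk (hS l) (hdivS l) x)) ≠ 0 → ∃ k v, lvl k = l ∧ cellPt S hS hdivS lvl zc k v = x)
  {amax : ℝ} (hamax : 0 ≤ amax)
  (hscale : ∀ k, a (lvl k) * ω (lvl k) (ctrU N (S (lvl k)) (zc k)) ^ 2 * (S (lvl k) : ℝ) ^ d ≤ amax / (S (lvl k) : ℝ) ^ 2)
  (c : UT N × Fin d → ℝ) {c₀ : ℝ} (hcc : ∀ b, c b = c₀) (hc₀ : c₀ ≠ 0)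
  {L : ℕ} (hL : 1 ≤ L) (e : J → ℕ) (hSe : ∀ l, S l = L ^ e l) {R : ℝ} (hR : 0 < R) {A : ℕ}
  (hadd : ∀ x y : UT N, |(e (lvl (cellOf S hS hdivS lvl zc hcover x)) : ℝ) - e (lvl (cellOf S hS hdivS lvl zc hcover y))| ≤
    A + sdist bsrc btgt (siteScale S hS hdivS lvl zc hcover) x y / R)
  {cmax : ℝ} (hc : ∀ b, |c b| ≤ cmax) {C : ℝ} (hC : 0 < C)
  (hcoer : ∀ f : UT N × Cp → ℝ,
    C * ∑ k, ((S (lvl k) : ℝ) ^ 2)⁻¹ * ∑ v : Box d (S (lvl k)), ∑ i, f (cellPt S hS hdivS lvl zc k v, i) ^ 2 ≤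
      ∑ p, f p * levelOp bsrc btgt c Rm (fun l x => ctrU N (S l) (tblk (hS l) (hdivS l) x))
        (fun l x => ω l (ctrU N (S l) (tblk (hS l) (hdivS l) x))) T a f p)
  {κ : ℝ} (hκ0 : 0 ≤ κ) (hκ1 : κ ≤ 1) (hμ : 0 < C - 2 * d * cmax ^ 2 * κ ^ 2 - amax * (Real.exp (2 * d * κ) - 1))
  (hrate : (1 + d / 2) * (Real.log L / R) ≤ κ)
  {Γ θ δ 𝔅 𝔅g K₁ K₂ : ℝ} (hΓ : Γ = (L : ℝ) ^ A * Real.exp (Real.log L / R * (4 * d + 1))) (hθ : θ = 1 / (4 * d * Γ))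
  (hδ : δ = κ - (1 + d / 2) * (Real.log L / R))
  (h𝔅 : 𝔅 = (max (Real.sqrt (11 ^ d)) (Cmv d * Real.sqrt (21 ^ d)) / Real.sqrt (θ ^ d) +
          Real.sqrt (Fintype.card Cp) * (θ + 1) ^ 2 * (amax * Γ ^ 2 * Real.sqrt (Γ ^ d)) / (2 * c₀ ^ 2)) *
        (Real.sqrt (Fintype.card Cp) * Real.exp (κ * ((4 * d + 1) + 2 * d)) *
          ((L : ℝ) ^ A * Real.exp (Real.log L / R * (4 * d + 1))) * (L : ℝ) ^ A * Real.sqrt (((L : ℝ) ^ A) ^ d) /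
          min (C - 2 * d * cmax ^ 2 * κ ^ 2 - amax * (Real.exp (2 * d * κ) - 1)) 1) +
        Real.sqrt (Fintype.card Cp) * (θ + 1) ^ 2 / (2 * c₀ ^ 2) *
          Real.exp ((κ - (1 + d / 2) * (Real.log L / R)) * ((4 * d + 1) + 2 * d)))
  (hK₁ : 0 ≤ K₁) (hK₂ : 0 ≤ K₂)
  (h𝔅g : 𝔅g = |c₀| * (𝔅 * (Γ ^ 2 * Real.exp δ + 1) * (16 * d * Γ) + K₁ * 𝔅 * Γ ^ 2 * Real.exp δ * (16 * d * Γ) +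
      K₂ * (θ / 4 + 1) * (Real.exp (δ * (2 * d + 1)) + amax * Real.sqrt (Fintype.card Cp) * 𝔅 * Real.exp (δ * (4 * d + 1))) / c₀ ^ 2))
  -- the cube family
  (M : ℕ) (hM : 1 ≤ M) (hMdiv : ∀ j i, M * S j ∣ N i) (inLayer : (j : J) → Ctr N (M * S j) → Prop)
  (h2N : ∀ j i, 2 * (M * S j) ≤ N i) (hcov : ∀ x, ∃ j, inLayer j (tblk (one_le_MS S hS hM j) (hMdiv j) x))
  (hcmp : ∀ (p q : Σ j : J, Ctr N (M * S j)) (x y : UT N), dist x y ≤ 2 →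
    rawFam S hS M hM hMdiv inLayer p x ≠ 0 → rawFam S hS M hM hMdiv inLayer q y ≠ 0 → S p.1 ≤ L * S q.1) {nadj : ℕ}
  (hlay : ∀ x, (univ.filter fun j : J => ∃ z : Ctr N (M * S j), rawFam S hS M hM hMdiv inLayer ⟨j, z⟩ x ≠ 0).card ≤ nadj)
  (hfar : ∀ (p : Σ j : J, Ctr N (M * S j)) k, ¬ (S p.1 ≤ L * S (lvl k) ∧ S (lvl k) ≤ L * S p.1) →
    ∀ v, cubeFam S hS M hM hMdiv inLayer p (cellPt S hS hdivS lvl zc k v) = 0)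
  -- the hull family with a margin
  (χ : (Σ j : J, Ctr N (M * S j)) → UT N → ℝ) (hχ : ∀ z x, χ z x = 0 ∨ χ z x = 1)
  (hχcell : ∀ z k v, χ z (cellPt S hS hdivS lvl zc k v) = χ z (ctrU N (S (lvl k)) (zc k)))
  (hsite : ∀ z x, cubeFam S hS M hM hMdiv inLayer z x ≠ 0 → χ z x = 1)
  (hbond : ∀ z b, (cubeFam S hS M hM hMdiv inLayer z (bsrc b) ≠ 0 ∨ cubeFam S hS M hM hMdiv inLayer z (btgt b) ≠ 0) →
    χ z (bsrc b) = 1 ∧ χ z (btgt b) = 1)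
  (hH : ∀ z x, χ z x = 1 → siteScale S hS hdivS lvl zc hcover x ≤ L * S z.1)
  (hχball : ∀ z : Σ j : J, Ctr N (M * S j), (∃ y, cubeFam S hS M hM hMdiv inLayer z y ≠ 0) → ∀ y : UT N,
    dist y (ctrU N (M * S z.1) z.2) ≤ ((((d + 2) * (M * S z.1) : ℕ) : ℝ) + 2 * d * (L * S z.1) + 1) +
      (8 * d + 3) * ((L : ℝ) ^ A * Real.exp (Real.log L / R * (8 * d + 3))) * (L * S z.1) → χ z y = 1)
  {ν : ℝ} (hν : ∀ x, ∑ z, χ z x ≤ ν)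


omit [∀ i, NeZero (N i)] [NeZero d] [Fintype Cp] [DecidableEq Cp] [Nonempty Cp] [Fintype J] [DecidableEq J] [Fintype K] [DecidableEq K] in
/-- The per-box constant is level-free: the box scale `S_j` cancels (`θ₁Λ`, `θ₂Λ²`, `m` against `1∕M`). [folklore] -/
theorem remConstWRS_eq (d' c' K₁' K₂' L' M' S' B D e₁ e₄ cp am : ℝ) (hM' : M' ≠ 0) (hS' : S' ≠ 0) :
    d' * (c' * K₁' / (M' * S')) * D * (L' * S') + d' * (c' * K₁' / (M' * S')) * e₁ * D * (L' * S') +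
        c' ^ 2 * (d' * K₂') / (M' * S') ^ 2 * B * (L' * S') ^ 2 + 2 * (d' * L' * K₁' / M') * e₄ * cp * am * B =
      (d' * c' * K₁' * L' * (1 + e₁) * D + c' ^ 2 * (d' * K₂') * L' ^ 2 * B / M' + 2 * (d' * L' * K₁') * e₄ * cp * am * B) / M' := by
  field_simp

include hdisj hT ha hsupp hamax hscale hL e hSe hR hadd hRm hflat hcc hc₀ hc hC hcoer hκ0 hκ1 hμ hrate hΓ hθ hδ h𝔅 hK₁ hK₂ h𝔅g h2N hcov
  hcmp hlay hfar hχ hχcell hsite hbond hH hχball hν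

-- buildfix (ops-buildfix-2 g10, 2026-08-21): the lane `lake build` hit the 200000-heartbeat cliff at this declaration
-- (T03 digest, batch 3.71 rc 1 `timeout at whnf` :140) while the farm check passes in 25 s; proof and statement unchanged.
set_option maxHeartbeats 400000 in
/-- **THE SCALE-ADAPTED PARAMETRIX OF THE MULTI-REGION MODEL OPERATOR IN THE (2.16)∕WRS CURRENCY, LEVEL-FREE (flat transport, constant
bond weight; MODEL; (FG) a hypothesis — d = 4: pass `FlatGradientBinderD4.flatGradient_binder_d4 hcc hc₀`).**  Setting: the analytic data of
files 17∕19b (cell-sum coercivity `C`, margin `μ₀ > 0`, graded sides with the additive datum, (P), rate `(1+d/2)log L/R ≤ κ`), the cube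
family `cubeFam` of a layer predicate with (C0)(C1)(C2)(G1), a hull family `χ` with `hχ`, `hχcell`, `hsite`, `hbond`, `hH` (hull scale
`L·S_j`) and the HULL-MARGIN clause `hχball`, the hull count `ν`, WRS parameters `0 ≤ κ′ ≤ δ`, `ε > 0` with `e^{ε+2(log L/R)d}e^{−(δ−κ′)} < 1`,
and, with `N_gr` the growth constant, `𝔅_W = 𝔅e^{2dδ}N_gr`, `𝔅_∇ = 𝔅_ge^{2dδ}N_gr` and
`C_K = (d|c₀|K₁L(1 + e^{κ′})𝔅_∇ + c₀²dK₂L²𝔅_W∕M + 2dLK₁e^{4dκ′}|Cp|a_max𝔅_W)∕M`, the smallness `ν·C_K < 1` («M sufficiently large», every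
constant seeing `d, L, A, R, n_adj, c₀, c_max, a_max, C, κ, κ′, ε, |Cp|, K₁, K₂` ONLY).  THEN: `1 − R′` is a unit, `(levelOp)⁻¹ = G′₀(1 − R′)⁻¹`,
`WRS_{κ′,d_n}(cmat (1 − R′)⁻¹) ≤ (1 − νC_K)⁻¹`, `WRS_{κ′,d_n}(cmat R′) ≤ νC_K`, and **`wrs_{κ′,d_n}(cmat (levelOp)⁻¹)(p) ≤ ν·𝔅_W·n(p₁)²∕(1 − νC_K)`**
for every row `p` — the random-walk∕Neumann representation of the inverse with LOCALISED terms and a level-free ratio.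
[cite: Balaban1985BackgroundPropagators, (3.87)–(3.91) pp.408–409 + Thm 3.7; Balaban1984PropagatorsII, (2.36)–(2.40) pp.229–230; Balaban1988RG2Cluster, (2.16) p.15] [folklore] -/
theorem parametrix_cubes_wrs
    (hFG : ∀ (x₀ : UT N) (R : ℕ), 1 ≤ R → (∀ i, 10 * R + 4 ≤ N i) → ∀ (w : UT N → ℝ) (M G : ℝ),
      (∀ x ∈ univ.filter (fun x : UT N => dist x x₀ ≤ 2 * R + 2), |w x| ≤ M) →
      (∀ x ∈ univ.filter (fun x : UT N => dist x x₀ ≤ 2 * R + 2),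
        |((∑ b ∈ univ.filter (fun b : UT N × Fin d => btgt b = x), c b ^ 2) +
              ∑ b ∈ univ.filter (fun b : UT N × Fin d => bsrc b = x), c b ^ 2) * w x -
            ((∑ b ∈ univ.filter (fun b : UT N × Fin d => btgt b = x), c b ^ 2 * w (bsrc b)) +
              ∑ b ∈ univ.filter (fun b : UT N × Fin d => bsrc b = x), c b ^ 2 * w (btgt b))| ≤ G) →
      ∀ μ, |w (up x₀ μ) - w x₀| ≤ K₁ * M / ((R : ℝ) + 1) + K₂ * ((R : ℝ) + 1) * G / c₀ ^ 2)
    {ε : ℝ} (hε : 0 < ε) {κ' : ℝ} (hκ'0 : 0 ≤ κ') (hκ'δ : κ' ≤ δ)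
    (hq : Real.exp (ε + 2 * (Real.log L / R) * d) * Real.exp (-(δ - κ')) < 1)
    {Ngr 𝔅W 𝔅D CK : ℝ}
    (hNgr : Ngr = (3 * ((L : ℝ) ^ A) ^ 2) ^ d * ((d.factorial : ℝ) / ε ^ d) * Real.exp (2 * d * (ε + Real.log L / R * d)) *
        Real.exp (ε + 2 * (Real.log L / R) * d) / (1 - Real.exp (ε + 2 * (Real.log L / R) * d) * Real.exp (-(δ - κ'))))
    (h𝔅W : 𝔅W = 𝔅 * Real.exp (2 * d * δ) * Ngr) (h𝔅D : 𝔅D = 𝔅g * Real.exp (2 * d * δ) * Ngr)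
    (hCK : CK = (d * |c₀| * K1 d L nadj * L * (1 + Real.exp κ') * 𝔅D + |c₀| ^ 2 * (d * K2 d L nadj) * L ^ 2 * 𝔅W / M +
        2 * (d * L * K1 d L nadj) * Real.exp (4 * d * κ') * Fintype.card Cp * amax * 𝔅W) / M)
    (hsmall : ν * CK < 1) :
    IsUnit (1 - Rsum bsrc btgt c Rm
        (levelSum (fun l x => ctrU N (S l) (tblk (hS l) (hdivS l) x)) (fun l x => ω l (ctrU N (S l) (tblk (hS l) (hdivS l) x))) T a)
        (levelOp bsrc btgt c Rm (fun l x => ctrU N (S l) (tblk (hS l) (hdivS l) x))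
          (fun l x => ω l (ctrU N (S l) (tblk (hS l) (hdivS l) x))) T a)
        (cubeFam S hS M hM hMdiv inLayer) χ) ∧
      Ring.inverse (levelOp bsrc btgt c Rm (fun l x => ctrU N (S l) (tblk (hS l) (hdivS l) x))
          (fun l x => ω l (ctrU N (S l) (tblk (hS l) (hdivS l) x))) T a) =
        G0sum (levelOp bsrc btgt c Rm (fun l x => ctrU N (S l) (tblk (hS l) (hdivS l) x))
          (fun l x => ω l (ctrU N (S l) (tblk (hS l) (hdivS l) x))) T a) (cubeFam S hS M hM hMdiv inLayer) χ *
        Ring.inverse (1 - Rsum bsrc btgt c Rm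
          (levelSum (fun l x => ctrU N (S l) (tblk (hS l) (hdivS l) x)) (fun l x => ω l (ctrU N (S l) (tblk (hS l) (hdivS l) x))) T a)
          (levelOp bsrc btgt c Rm (fun l x => ctrU N (S l) (tblk (hS l) (hdivS l) x))
            (fun l x => ω l (ctrU N (S l) (tblk (hS l) (hdivS l) x))) T a)
          (cubeFam S hS M hM hMdiv inLayer) χ) ∧
      WRS κ' (fun p q : UT N × Cp => sdist bsrc btgt (siteScale S hS hdivS lvl zc hcover) p.1 q.1)
        (cmat (Ring.inverse (1 - Rsum bsrc btgt c Rm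
          (levelSum (fun l x => ctrU N (S l) (tblk (hS l) (hdivS l) x)) (fun l x => ω l (ctrU N (S l) (tblk (hS l) (hdivS l) x))) T a)
          (levelOp bsrc btgt c Rm (fun l x => ctrU N (S l) (tblk (hS l) (hdivS l) x))
            (fun l x => ω l (ctrU N (S l) (tblk (hS l) (hdivS l) x))) T a)
          (cubeFam S hS M hM hMdiv inLayer) χ))) (1 - ν * CK)⁻¹ ∧
      WRS κ' (fun p q : UT N × Cp => sdist bsrc btgt (siteScale S hS hdivS lvl zc hcover) p.1 q.1)
        (cmat (Rsum bsrc btgt c Rm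
          (levelSum (fun l x => ctrU N (S l) (tblk (hS l) (hdivS l) x)) (fun l x => ω l (ctrU N (S l) (tblk (hS l) (hdivS l) x))) T a)
          (levelOp bsrc btgt c Rm (fun l x => ctrU N (S l) (tblk (hS l) (hdivS l) x))
            (fun l x => ω l (ctrU N (S l) (tblk (hS l) (hdivS l) x))) T a)
          (cubeFam S hS M hM hMdiv inLayer) χ)) (ν * CK) ∧
      ∀ p : UT N × Cp, wrs κ' (fun p q : UT N × Cp => sdist bsrc btgt (siteScale S hS hdivS lvl zc hcover) p.1 q.1)
        (cmat (Ring.inverse (levelOp bsrc btgt c Rm (fun l x => ctrU N (S l) (tblk (hS l) (hdivS l) x))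
          (fun l x => ω l (ctrU N (S l) (tblk (hS l) (hdivS l) x))) T a))) p ≤
        ν * (𝔅W * (siteScale S hS hdivS lvl zc hcover p.1 : ℝ) ^ 2) / (1 - ν * CK) := by
  classical
  -- abbreviations
  set A_ := levelOp bsrc btgt c Rm (fun l x => ctrU N (S l) (tblk (hS l) (hdivS l) x))
    (fun l x => ω l (ctrU N (S l) (tblk (hS l) (hdivS l) x))) T a with hAdef
  set Q_ := levelSum (fun l x => ctrU N (S l) (tblk (hS l) (hdivS l) x))
    (fun l x => ω l (ctrU N (S l) (tblk (hS l) (hdivS l) x))) T a with hQdef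
  set n := siteScale S hS hdivS lvl zc hcover with hn
  set hs := cubeFam S hS M hM hMdiv inLayer with hhs
  set E : UT N × Cp → UT N × Cp → ℝ := fun p q => Real.exp (κ' * sdist bsrc btgt n p.1 q.1) with hE
  set Γ8 : ℝ := (L : ℝ) ^ A * Real.exp (Real.log L / R * (8 * d + 3)) with hΓ8
  -- the K-set ∕ interiority predicate of a box
  set Kset : (Σ j : J, Ctr N (M * S j)) → UT N → Prop := fun z x =>
    (∃ y, hs z y ≠ 0) ∧ dist x (ctrU N (M * S z.1) z.2) ≤ (((d + 2) * (M * S z.1) : ℕ) : ℝ) + 2 * d * (L * S z.1) + 1 with hKset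
  haveI hdec : ∀ z, DecidablePred (Kset z) := fun z => Classical.decPred _
  -- positivity facts
  have hM0 : (0 : ℝ) < M := by exact_mod_cast hM
  have hL1 : (1 : ℝ) ≤ L := by exact_mod_cast hL
  have hK1 := K1_nonneg d L nadj
  have hK2 := K2_nonneg d L nadj
  have hδ0 : 0 ≤ δ := by
    have hd0 : (0 : ℝ) ≤ d := Nat.cast_nonneg _
    rw [hδ]; linarith
  have hΓ1 : 1 ≤ Γ := by
    rw [hΓ]
    exact one_le_mul_of_one_le_of_one_le (one_le_pow₀ hL1)
      (Real.one_le_exp (mul_nonneg (div_nonneg (Real.log_nonneg hL1) hR.le) (by positivity)))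
  have hΓ0 : 0 < Γ := by linarith
  have hθ0 : 0 ≤ θ := by rw [hθ]; positivity
  have h𝔅0 : 0 ≤ 𝔅 := by rw [h𝔅]; positivity
  have h𝔅g0 : 0 ≤ 𝔅g := by rw [h𝔅g]; positivity
  have hNgr0 : 0 ≤ Ngr := by
    rw [hNgr]
    have h1 : 0 < 1 - Real.exp (ε + 2 * (Real.log L / R) * d) * Real.exp (-(δ - κ')) := by linarith
    positivity
  have h𝔅W0 : 0 ≤ 𝔅W := by rw [h𝔅W]; positivity
  have h𝔅D0 : 0 ≤ 𝔅D := by rw [h𝔅D]; positivity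
  have hCK0 : 0 ≤ CK := by rw [hCK]; positivity
  have hEnn : ∀ p q, 0 ≤ E p q := fun p q => (Real.exp_pos _).le
  -- the margin: the `d_n`-balls of radius `8d+2` about the K-sites lie in the hull, and `n ≤ L S_j` there
  have hKχ : ∀ z x, Kset z x → χ z x = 1 := by
    intro z x hx
    refine hχball z hx.1 x ?_
    have : 0 ≤ (8 * d + 3) * Γ8 * (L * S z.1) := by positivity
    linarith [hx.2]
  have hKn : ∀ z x, Kset z x → (n x : ℝ) ≤ L * S z.1 := by
    intro z x hx
    exact_mod_cast hH z x (hKχ z x hx)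
  have hKint : ∀ z x, Kset z x → ∀ q : UT N, sdist bsrc btgt n q x ≤ 8 * d + 2 → χ z q = 1 := by
    intro z x hx q hq
    exact eq_one_of_sdist_le_of_ball S hS hdivS lvl zc hcover hL e hSe hR hadd (χ z) (ctrU N (M * S z.1) z.2)
      (fun y hy => hχball z hx.1 y hy) le_rfl x hx.2 (hKn z x hx) q hq
  -- the members (W1), (W2) of the local propagators at K-sites
  have hW1 : ∀ z (p : UT N × Cp), Kset z p.1 →
      ∑ q, |(dirInv A_ (χ z ∘ Prod.fst) * mulOp (hs z ∘ Prod.fst) : Module.End ℝ (UT N × Cp → ℝ)) (Pi.single q 1) p| * E p q ≤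
        𝔅W * (n p.1 : ℝ) ^ 2 := by
    intro z p hp
    have hred := row_mul_mulOp_le (hs z) (abs_cubeFam_le_one S hS M hM hMdiv inLayer z) (dirInv A_ (χ z ∘ Prod.fst))
      (LinearMap.proj p) (E p) (hEnn p)
    simp only [LinearMap.coe_proj, Function.eval] at hred
    refine hred.trans ?_
    have h := wrs_dirInv_le_of_grading S hS hdivS lvl zc hdisj hcover Rm hRm T hT a ha ω hsupp hamax hscale c hcc hc₀ hL e hSe hR hadd
      hc hcoer hκ0 hκ1 hμ hrate hΓ hθ hδ h𝔅 (χ z ∘ Prod.fst) (fun q => hχ z q.1) hε hκ'0 hκ'δ hq p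
      (fun q hq' => hKint z p.1 hp q.1 (by linarith))
    rw [h𝔅W, hNgr]
    simpa only [hAdef, hn, hE] using h
  have hW2 : ∀ z (b : UT N × Fin d) (i : Cp), Kset z (bsrc b) →
      ∑ q, |covD bsrc btgt c Rm ((dirInv A_ (χ z ∘ Prod.fst) * mulOp (hs z ∘ Prod.fst) : Module.End ℝ (UT N × Cp → ℝ))
          (Pi.single q 1)) (b, i)| * E (bsrc b, i) q ≤ 𝔅D * (n (bsrc b) : ℝ) := by
    intro z b i hb
    have hred := row_mul_mulOp_le (hs z) (abs_cubeFam_le_one S hS M hM hMdiv inLayer z) (dirInv A_ (χ z ∘ Prod.fst))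
      ((LinearMap.proj (b, i)) ∘ₗ covD bsrc btgt c Rm) (E (bsrc b, i)) (hEnn _)
    simp only [LinearMap.coe_comp, LinearMap.coe_proj, Function.comp_apply, Function.eval] at hred
    refine hred.trans ?_
    have h := wrs_grad_dirInv_le_of_grading S hS hdivS lvl zc hdisj hcover Rm hRm hflat T hT a ha ω hsupp hamax hscale c hcc hc₀ hL e
      hSe hR hadd hc hcoer hκ0 hκ1 hμ hrate hΓ hθ hδ h𝔅 hK₁ hK₂ h𝔅g (χ z ∘ Prod.fst) (fun q => hχ z q.1) hFG hε hκ'0 hκ'δ hq b i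
      (fun q hq' => hKint z (bsrc b) hb q.1 hq')
    rw [h𝔅D, hNgr]
    simpa only [hAdef, hn, hE] using h
  -- per-box geometric facts: K-sites
  have hSj : ∀ z : Σ j : J, Ctr N (M * S j), (1 : ℝ) ≤ S z.1 := fun z => by exact_mod_cast hS z.1
  have hr0 : ∀ z : Σ j : J, Ctr N (M * S j), (0 : ℝ) ≤ 2 * d * (L * S z.1) := fun z => by positivity
  have hKb : ∀ z b, c b * (hs z (btgt b) - hs z (bsrc b)) ≠ 0 → Kset z (bsrc b) ∧ Kset z (btgt b) := by
    intro z b hb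
    have hdh : hs z (btgt b) - hs z (bsrc b) ≠ 0 := right_ne_zero_of_mul hb
    have hact : ∃ y, hs z y ≠ 0 := by
      by_contra hc0
      push Not at hc0
      exact hdh (by rw [hc0, hc0, sub_zero])
    have hd := dist_le_of_dh_ne_zero S hS M hM hMdiv inLayer z b hdh
    exact ⟨⟨hact, by linarith [hd.1, hr0 z]⟩, ⟨hact, by linarith [hd.2, hr0 z]⟩⟩
  have hKl : ∀ z x, lapH bsrc btgt c (hs z) x ≠ 0 → Kset z x := by
    intro z x hx
    obtain ⟨b, -, hb⟩ := exists_bond_of_lapH_ne_zero c (hs z) x hx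
    have hact : ∃ y, hs z y ≠ 0 := by
      by_contra hc0
      push Not at hc0
      exact hb (by rw [hc0, hc0, sub_zero])
    have hd := dist_le_of_lapH_ne_zero S hS M hM hMdiv inLayer c z x hx
    exact ⟨hact, by linarith [hr0 z]⟩
  have hKcell : ∀ z k (v v' : Box d (S (lvl k))), hs z (cellPt S hS hdivS lvl zc k v) ≠ hs z (cellPt S hS hdivS lvl zc k v') →
      ∀ w, Kset z (cellPt S hS hdivS lvl zc k w) := by
    intro z k v v' hne w
    have hact : ∃ y, hs z y ≠ 0 := by
      by_contra hc0
      push Not at hc0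
      exact hne (by rw [hc0, hc0])
    have hd := (dist_cellPt_le_of_ne S hS hdivS lvl zc M hM hMdiv inLayer hfar z k v v' hne w).1
    exact ⟨hact, by linarith⟩
  have hKc : ∀ z k (v : Box d (S (lvl k))), hs z (cellPt S hS hdivS lvl zc k v) ≠ hs z (ctrU N (S (lvl k)) (zc k)) →
      ∀ w, Kset z (cellPt S hS hdivS lvl zc k w) := by
    intro z k v hne w
    have hcorner : ctrU N (S (lvl k)) (zc k) = cellPt S hS hdivS lvl zc k (fun _ => ⟨0, hS (lvl k)⟩) := by rw [cellPt, cubePt_zero]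
    rw [hcorner] at hne
    exact hKcell z k v _ hne w
  -- per box: the remainder rows (brick (c))
  have hKwrs : ∀ z (p : UT N × Cp), Kset z p.1 →
      wrs κ' (fun p q : UT N × Cp => sdist bsrc btgt n p.1 q.1)
        (cmat (remK bsrc btgt c Rm Q_ (hs z) * dirInv A_ (χ z ∘ Prod.fst) * mulOp (hs z ∘ Prod.fst))) p ≤ CK := by
    intro z p hp
    rw [mul_assoc, wrs_cmat_sdist_eq]
    have hrow := row_remK_mul_le S hS hdivS lvl zc hdisj hcover T a ω c Rm (hs z)
      (dirInv A_ (χ z ∘ Prod.fst) * mulOp (hs z ∘ Prod.fst)) hRm hflat hT ha hsupp hscale (Kset z)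
      (θ₁ := |c₀| * K1 d L nadj / ((M : ℝ) * S z.1)) (θ₂ := |c₀| ^ 2 * (d * K2 d L nadj) / ((M : ℝ) * S z.1) ^ 2)
      (m := d * L * K1 d L nadj / M) (Λs := L * S z.1) (𝔅w := 𝔅W) (𝔅g := 𝔅D) (κ' := κ')
      (by positivity) (by positivity) (by positivity) (by positivity) h𝔅W0 h𝔅D0 hκ'0
      (cubeFam_cdh_le S hS M hM hMdiv inLayer h2N hcov hcmp hlay hcc z)
      (cubeFam_lap_le S hS M hM hMdiv inLayer h2N hcov hcmp hlay hcc z)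
      (cubeFam_cell_osc_le S hS hdivS lvl zc M hM hMdiv inLayer h2N hcov hcmp hlay hfar z)
      (fun b hb => (hKb z b hb).1) (hKl z) (hKc z) (hKn z) (hW1 z) (hW2 z) p
    refine hrow.trans (le_of_eq ?_)
    have hS0 : (S z.1 : ℝ) ≠ 0 := by linarith [hSj z]
    rw [hCK]
    exact remConstWRS_eq _ _ _ _ _ _ _ _ _ _ _ _ _ hM0.ne' hS0
  -- the local part
  have hPwrs : ∀ z (p : UT N × Cp), hs z p.1 ≠ 0 →
      wrs κ' (fun p q : UT N × Cp => sdist bsrc btgt n p.1 q.1)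
        (cmat (mulOp (hs z ∘ Prod.fst) * dirInv A_ (χ z ∘ Prod.fst) * mulOp (hs z ∘ Prod.fst))) p ≤ 𝔅W * (n p.1 : ℝ) ^ 2 := by
    intro z p hp
    rw [mul_assoc, wrs_cmat_sdist_eq, row_mulOp_mul_eq]
    have hK : Kset z p.1 :=
      ⟨⟨p.1, hp⟩, by linarith [cubeFam_supp S hS M hM hMdiv inLayer z p.1 hp, hr0 z]⟩
    calc |hs z p.1| * ∑ q, |(dirInv A_ (χ z ∘ Prod.fst) * mulOp (hs z ∘ Prod.fst) : Module.End ℝ (UT N × Cp → ℝ))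
          (Pi.single q 1) p| * E p q
        ≤ 1 * (𝔅W * (n p.1 : ℝ) ^ 2) :=
          mul_le_mul (abs_cubeFam_le_one S hS M hM hMdiv inLayer z p.1) (hW1 z p hK)
            (Finset.sum_nonneg fun q _ => by positivity) zero_le_one
      _ = 𝔅W * (n p.1 : ℝ) ^ 2 := one_mul _
  -- assemble with brick (d)
  have hA := posDef_of_coercive S hS hdivS lvl zc hdisj hcover A_ hC hcoer
  refine parametrix_levelOp_wrs bsrc btgt c Rm (fun l x => ctrU N (S l) (tblk (hS l) (hdivS l) x))
    (fun l x => ω l (ctrU N (S l) (tblk (hS l) (hdivS l) x))) T a hA hs (cubeFam_sum_sq S hS M hM hMdiv inLayer h2N hcov)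
    χ hχ hsite hbond (fun z l β => χ z β)
    (fun z l x hx => blockConst_of_cellConst S hS hdivS lvl zc ω hsupp (χ z) (hχcell z) l x hx)
    (weightHyp_sdist_torus n hκ'0) Kset
    (fun z p hp q => by
      -- the rows of the remainder term vanish off the K-set (`remK_mul_apply_eq_zero`)
      rw [mul_assoc]
      refine remK_mul_apply_eq_zero S hS hdivS lvl zc hdisj hcover T a ω c Rm (hs z) _ hRm hsupp (Pi.single q 1) p
        ?_ ?_ ?_ ?_
      · intro b hb
        by_contra hne
        exact hp (hb ▸ (hKb z b hne).1)
      · intro b hb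
        by_contra hne
        exact hp (hb ▸ (hKb z b hne).2)
      · by_contra hne
        exact hp (hKl z p.1 hne)
      · intro y hy
        by_contra hne
        obtain ⟨v, hv⟩ := (tblk_eq_iff (hS (lvl (cellOf S hS hdivS lvl zc hcover p.1)))
          (hdivS (lvl (cellOf S hS hdivS lvl zc hcover p.1))) p.1 (zc (cellOf S hS hdivS lvl zc hcover p.1))).mp
          (tblk_eq_zc S hS hdivS lvl zc hdisj hcover p.1 _ rfl)
        obtain ⟨w, hw⟩ := (tblk_eq_iff (hS (lvl (cellOf S hS hdivS lvl zc hcover p.1)))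
          (hdivS (lvl (cellOf S hS hdivS lvl zc hcover p.1))) y (zc (cellOf S hS hdivS lvl zc hcover p.1))).mp
          (tblk_eq_zc S hS hdivS lvl zc hdisj hcover y _ hy)
        have hne' : hs z (cellPt S hS hdivS lvl zc (cellOf S hS hdivS lvl zc hcover p.1) w) ≠
            hs z (cellPt S hS hdivS lvl zc (cellOf S hS hdivS lvl zc hcover p.1) v) := by
          rw [show cellPt S hS hdivS lvl zc _ w = y from hw, show cellPt S hS hdivS lvl zc _ v = p.1 from hv]; exact hne
        have hK := hKcell z _ w v hne' v
        rw [show cellPt S hS hdivS lvl zc _ v = p.1 from hv] at hK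
        exact hp hK)
    hCK0 hKwrs ?_
    (fun p => 𝔅W * (n p.1 : ℝ) ^ 2) (fun p => mul_nonneg h𝔅W0 (pow_nonneg (Nat.cast_nonneg _) 2)) hPwrs ?_ hsmall
  · -- the K-sets lie in the hulls: `ν_K ≤ ν`
    intro x
    exact (@card_Kset_le _ _ _ _ χ hχ Kset (_) hKχ x).trans (hν x)
  · -- the supports lie in the hulls: `#{□ : h_□(x) ≠ 0} ≤ ν`
    intro x
    exact (@card_Kset_le _ _ _ _ χ hχ (fun z x => hs z x ≠ 0) (_) (fun z x hx => hsite z x hx) x).trans (hν x)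

end

end Summit.QuantumFields.BalabanUV.Beta.MultiscaleParametrixCubesWRS
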